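import Mathlib.Analysis.InnerProductSpace.Basic
import Mathlib.Analysis.InnerProductSpace.LinearMap
import Mathlib.Topology.Algebra.Module.FiniteDimension
import Mathlib.LinearAlgebra.Eigenspace.Zero
import Mathlib.LinearAlgebra.Eigenspace.Charpoly
import Mathlib.LinearAlgebra.Charpoly.ToMatrix
import Mathlib.LinearAlgebra.Matrix.Charpoly.Coeff
import Mathlib.LinearAlgebra.Trace
import HarnessLib

/-!
# A three-dimensional operator with a simple eigenvalue `0`: the bordered operator
# `A + ⟪e, ·⟫ e` is invertible (Hoffman–Kunze §5.3 Ex. 8, §6.2)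

Topic `Literature/LinearAlgebra`.  Everything here is PROVED (no named fact).

Setting (Hoffman–Kunze, *Linear Algebra*, §5.3 Exercise 8: "Let `A` be a `3 × 3` matrix [...]
`f = det(xI − A)` [...] is a monic polynomial of degree `3`. If we write `f = (x − c₁)(x − c₂)(x − c₃)`
[...] prove that `c₁ + c₂ + c₃ = trace(A)` and `c₁c₂c₃ = det A`"; §6.2: "`c` is a characteristic value
of `T` if and only if `det(T − cI) = 0`", i.e. the characteristic values are the roots of the
characteristic polynomial).  Let `E` be a real inner-product space of dimension `3` and `A : E →L[ℝ] E`
with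

* an eigenvector `v ≠ 0`, `A v = λ v`, `λ ≠ 0`;
* a kernel vector `e`, `‖e‖ = 1`, `A e = 0`;
* `μ := trace A − λ ≠ 0` (the third root of the characteristic polynomial; `μ = λ` is allowed).

Then the characteristic polynomial is `X (X − λ)(X − μ) = X (X² − (trace A) X + λμ)`
(`charpoly_eq_X_mul_of_kernel_of_eigen`), so `0` is a SIMPLE root: `ker A = ℝ e`
(`eigenspace_zero_eq_span`), and the **bordered operator `A + ⟪e, ·⟫ e` is invertible**
(`exists_borderedEquiv_of_kernel_of_eigen`, delivered as `T : E ≃L[ℝ] E` with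
`(T : E →L[ℝ] E) = A + (innerSL ℝ e).smulRight e`).

Consumer (the binder shape is theirs): the Navier–Stokes §B crux `PowerGaugeEulerLiouville`
(stmt-NavierStokesRegularity-19832), classical portrait, NO-DRIFT step at a VORTICAL non-isolated
stagnation point `z_b` of the self-similar transport field `W = γy + V`: there `A = DW(z_b)` has
`A Ω(z_b) = (1+γ) Ω(z_b)`, `A e = 0` along the node arc, `trace A = 3γ`, so `μ = 2γ − 1 ≠ 0` in the
window `γ ≠ ½`, and `exists_zeroCurve_of_corankOne` / `exists_driftChart` (Theorems files
`…SelfSimilarCorankOneZeroCurve`, `…SelfSimilarDriftChart`) consume exactly the pair `(T, hT)` produced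
here.  WHAT THIS IS NOT: not NS — linear algebra.

## References

* K. Hoffman, R. Kunze, *Linear Algebra*, 2nd ed., Prentice–Hall (1971), §5.3 Exercise 8 (p. 155),
  §6.2 (characteristic values = roots of the characteristic polynomial), §6.3 Exercise 9
  (`Σ cᵢdᵢ = trace`). [HoffmanKunze1971LinearAlgebra]
-/

noncomputable section

open Module Polynomial
open scoped RealInnerProductSpace

namespace Literature.LinearAlgebra

variable {E : Type*} [NormedAddCommGroup E] [InnerProductSpace ℝ E] [FiniteDimensional ℝ E]

/-- **The characteristic polynomial of a `3`-dimensional operator with a kernel vector and an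
eigenvalue `λ ≠ 0`** (Hoffman–Kunze §5.3 Ex. 8: monic cubic, `c₁ + c₂ + c₃ = trace`, `c₁c₂c₃ = det`):
`χ_A = X · (X² − (trace A)·X + λ(trace A − λ))`, i.e. the roots are `0, λ, trace A − λ`.
[cite: HoffmanKunze1971LinearAlgebra, §5.3 Exercise 8 and §6.2] -/
theorem charpoly_eq_X_mul_of_kernel_of_eigen (h3 : finrank ℝ E = 3) (A : E →ₗ[ℝ] E)
    {v e : E} {lam : ℝ} (hv : v ≠ 0) (hAv : A v = lam • v) (hlam : lam ≠ 0) (he : e ≠ 0)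
    (hAe : A e = 0) :
    A.charpoly = X * (X ^ 2 - C (LinearMap.trace ℝ E A) * X +
      C (lam * (LinearMap.trace ℝ E A - lam))) := by
  set p := A.charpoly with hp
  have hmonic : p.Monic := A.charpoly_monic
  have hdeg : p.natDegree = 3 := by rw [hp, A.charpoly_natDegree, h3]
  -- roots `0` and `lam`
  have hroot0 : p.IsRoot 0 := by
    rw [hp, ← Module.End.hasEigenvalue_iff_isRoot_charpoly]
    exact Module.End.hasEigenvalue_of_hasEigenvector
      ⟨by rw [Module.End.mem_eigenspace_iff, hAe, zero_smul], he⟩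
  have hrootl : p.IsRoot lam := by
    rw [hp, ← Module.End.hasEigenvalue_iff_isRoot_charpoly]
    exact Module.End.hasEigenvalue_of_hasEigenvector
      ⟨by rw [Module.End.mem_eigenspace_iff, hAv], hv⟩
  -- the `X²`-coefficient is `−trace`
  have htr : LinearMap.trace ℝ E A = -p.coeff 2 := by
    let b := Module.finBasisOfFinrankEq ℝ E h3
    rw [LinearMap.trace_eq_matrix_trace ℝ b A, Matrix.trace_eq_neg_charpoly_coeff,
      LinearMap.charpoly_toMatrix A b]
    simp [hp]
  -- expand the monic cubic
  have hsum : p = X ^ 3 + C (p.coeff 2) * X ^ 2 + C (p.coeff 1) * X + C (p.coeff 0) := by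
    have := hmonic.as_sum
    rw [hdeg] at this
    rw [this]
    simp [Finset.sum_range_succ]
    ring
  have hc0 : p.coeff 0 = 0 := by
    have h := hroot0.eq_zero
    rwa [← Polynomial.coeff_zero_eq_eval_zero] at h
  have hc1 : p.coeff 1 = lam * (LinearMap.trace ℝ E A - lam) := by
    have h := hrootl.eq_zero
    rw [hsum] at h
    simp only [eval_add, eval_mul, eval_pow, eval_X, eval_C, hc0] at h
    -- `lam³ + c₂ lam² + c₁ lam = 0`, divide by `lam`
    have h' : lam * (lam ^ 2 + p.coeff 2 * lam + p.coeff 1) = 0 := by linear_combination h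
    rcases mul_eq_zero.1 h' with h'' | h''
    · exact absurd h'' hlam
    · rw [htr]; linear_combination h''
  rw [hsum, hc0, hc1, htr]
  simp only [map_zero, add_zero, map_neg]
  ring

/-- In the situation of `charpoly_eq_X_mul_of_kernel_of_eigen` with moreover `trace A − λ ≠ 0`, the
root `0` of the characteristic polynomial is SIMPLE, so the kernel is the line through `e`
("geometric multiplicity ≤ algebraic multiplicity", Mathlib `LinearMap.finrank_eigenspace_le`).
[cite: HoffmanKunze1971LinearAlgebra, §5.3 Exercise 8 and §6.2] -/
theorem eigenspace_zero_eq_span (h3 : finrank ℝ E = 3) (A : E →ₗ[ℝ] E)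
    {v e : E} {lam : ℝ} (hv : v ≠ 0) (hAv : A v = lam • v) (hlam : lam ≠ 0) (he : e ≠ 0)
    (hAe : A e = 0) (hmu : LinearMap.trace ℝ E A - lam ≠ 0) :
    Module.End.eigenspace A 0 = ℝ ∙ e := by
  have hchar := charpoly_eq_X_mul_of_kernel_of_eigen h3 A hv hAv hlam he hAe
  set q : ℝ[X] := X ^ 2 - C (LinearMap.trace ℝ E A) * X +
    C (lam * (LinearMap.trace ℝ E A - lam)) with hq
  have hq0 : ¬ q.IsRoot 0 := by
    rw [IsRoot.def, hq]
    simp only [eval_add, eval_sub, eval_mul, eval_pow, eval_X, eval_C]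
    simpa using mul_ne_zero hlam hmu
  have hXne : (X : ℝ[X]) * q ≠ 0 :=
    mul_ne_zero X_ne_zero (fun h => hq0 (by rw [h]; simp))
  have hmult : A.charpoly.rootMultiplicity 0 = 1 := by
    rw [hchar, rootMultiplicity_mul hXne, rootMultiplicity_eq_zero hq0, add_zero]
    simpa using (rootMultiplicity_X_sub_C_self (x := (0 : ℝ)))
  have hle : finrank ℝ (Module.End.eigenspace A 0) ≤ 1 := by
    have := LinearMap.finrank_eigenspace_le A 0
    rwa [hmult] at this
  have hsub : (ℝ ∙ e) ≤ Module.End.eigenspace A 0 := by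
    rw [Submodule.span_singleton_le_iff_mem, Module.End.mem_eigenspace_iff, hAe, zero_smul]
  exact (Submodule.eq_of_le_of_finrank_le hsub (by rw [finrank_span_singleton he]; exact hle)).symm

/-- **The bordered operator at a simple kernel vector is invertible.**  Let `E` be a real inner
product space of dimension `3`, `A : E →L[ℝ] E` with an eigenvector `A v = λ v` (`v ≠ 0`, `λ ≠ 0`), a
unit kernel vector `A e = 0`, and third root `μ = trace A − λ ≠ 0` (`μ = λ` allowed).  Then
`A + ⟪e, ·⟫ e` is invertible: there is `T : E ≃L[ℝ] E` with `T = A + ⟪e, ·⟫ e`.  (Proof: with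
`q = χ_A / X`, `q(0) = λμ ≠ 0` and `q(A) ∘ A = χ_A(A) = 0` (Cayley–Hamilton); if `A x = −⟪e,x⟫ e`
then applying `q(A)` gives `⟪e, x⟫ λμ e = 0`, so `⟪e, x⟫ = 0`, `A x = 0`, `x ∈ ℝ e`, `x = 0`;
an injective endomorphism of a finite-dimensional space is invertible.)
[cite: HoffmanKunze1971LinearAlgebra, §5.3 Exercise 8 and §6.2] -/
theorem exists_borderedEquiv_of_kernel_of_eigen (h3 : finrank ℝ E = 3) (A : E →L[ℝ] E)
    {v e : E} {lam : ℝ} (hv : v ≠ 0) (hAv : A v = lam • v) (hlam : lam ≠ 0) (he : ‖e‖ = 1)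
    (hAe : A e = 0) (hmu : LinearMap.trace ℝ E (A : E →ₗ[ℝ] E) - lam ≠ 0) :
    ∃ T : E ≃L[ℝ] E, (T : E →L[ℝ] E) = A + (innerSL ℝ e).smulRight e := by
  have he0 : e ≠ 0 := by
    intro h; rw [h, norm_zero] at he; exact zero_ne_one he
  set f : E →ₗ[ℝ] E := (A : E →ₗ[ℝ] E) with hf
  have hfv : f v = lam • v := by simpa [hf] using hAv
  have hfe : f e = 0 := by simpa [hf] using hAe
  have hchar := charpoly_eq_X_mul_of_kernel_of_eigen h3 f hv hfv hlam he0 hfe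
  have hker := eigenspace_zero_eq_span h3 f hv hfv hlam he0 hfe hmu
  set τ : ℝ := LinearMap.trace ℝ E f with hτ
  set c₁ : ℝ := lam * (τ - lam) with hc₁
  have hc₁0 : c₁ ≠ 0 := mul_ne_zero hlam hmu
  set q : ℝ[X] := X ^ 2 - C τ * X + C c₁ with hq
  -- Cayley–Hamilton: `q(f) ∘ f = χ_f(f) = 0`
  have hCH : ∀ x, aeval f q (f x) = 0 := by
    intro x
    have h0 : aeval f f.charpoly = 0 := f.aeval_self_charpoly
    rw [hchar, mul_comm, map_mul, aeval_X] at h0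
    simpa using congrArg (fun g : E →ₗ[ℝ] E => g x) h0
  -- `q(f) e = λμ e`
  have hqe : aeval f q e = c₁ • e := by
    have h2 : (f ^ 2) e = 0 := by rw [pow_two, Module.End.mul_apply, hfe, map_zero]
    rw [hq]
    simp only [map_add, map_sub, map_mul, map_pow, aeval_X, aeval_C, LinearMap.add_apply,
      LinearMap.sub_apply, Module.End.mul_apply, hfe, map_zero, h2, sub_zero, zero_add,
      Module.algebraMap_end_apply]
  -- injectivity of the bordered operator
  set T₀ : E →L[ℝ] E := A + (innerSL ℝ e).smulRight e with hT₀
  have hT₀_apply : ∀ x, T₀ x = A x + ⟪e, x⟫ • e := fun x => by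
    simp [hT₀, ContinuousLinearMap.smulRight_apply, innerSL_apply_apply]
  have hinj : Function.Injective T₀ := by
    refine (injective_iff_map_eq_zero T₀).2 fun x hx => ?_
    rw [hT₀_apply] at hx
    have hAx : f x = -(⟪e, x⟫ • e) := by
      rw [hf, ContinuousLinearMap.coe_coe]; exact eq_neg_of_add_eq_zero_left hx
    -- apply `q(f)`
    have h1 : (⟪e, x⟫ * c₁) • e = 0 := by
      have := hCH x
      rw [hAx, map_neg, map_smul, hqe, smul_smul, neg_eq_zero] at this
      exact this
    have hinner : ⟪e, x⟫ = 0 := by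
      rcases smul_eq_zero.1 h1 with h | h
      · rcases mul_eq_zero.1 h with h' | h'
        · exact h'
        · exact absurd h' hc₁0
      · exact absurd h he0
    have hx0 : f x = 0 := by rw [hAx, hinner, zero_smul, neg_zero]
    have hxmem : x ∈ Module.End.eigenspace f 0 := by
      rw [Module.End.mem_eigenspace_iff, hx0, zero_smul]
    rw [hker, Submodule.mem_span_singleton] at hxmem
    obtain ⟨t, rfl⟩ := hxmem
    have : t = 0 := by
      have h := hinner
      rw [inner_smul_right, real_inner_self_eq_norm_sq, he] at h
      simpa using h
    rw [this, zero_smul]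
  -- injective endomorphism of a finite-dimensional space ⇒ equivalence
  have hbij : Function.Bijective (T₀ : E →ₗ[ℝ] E) :=
    ⟨hinj, LinearMap.injective_iff_surjective.1 hinj⟩
  refine ⟨(LinearEquiv.ofBijective (T₀ : E →ₗ[ℝ] E) hbij).toContinuousLinearEquiv, ?_⟩
  ext x
  rfl

/-- The same, with the eigen-data phrased for the Navier–Stokes consumer: `A Ω = (1 + γ) Ω`,
`A e = 0`, `trace A = 3γ`, `γ ≠ ½`, `γ ≠ −1` (so `λ = 1 + γ ≠ 0`, `μ = 2γ − 1 ≠ 0`).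
[cite: HoffmanKunze1971LinearAlgebra, §5.3 Exercise 8 and §6.2] -/
theorem exists_borderedEquiv_of_vortical_node (h3 : finrank ℝ E = 3) (A : E →L[ℝ] E)
    {Ω e : E} {γ : ℝ} (hΩ : Ω ≠ 0) (hAΩ : A Ω = (1 + γ) • Ω) (he : ‖e‖ = 1) (hAe : A e = 0)
    (htr : LinearMap.trace ℝ E (A : E →ₗ[ℝ] E) = 3 * γ) (hγ : γ ≠ 1 / 2) (hγ' : γ ≠ -1) :
    ∃ T : E ≃L[ℝ] E, (T : E →L[ℝ] E) = A + (innerSL ℝ e).smulRight e := by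
  refine exists_borderedEquiv_of_kernel_of_eigen h3 A hΩ hAΩ ?_ he hAe ?_
  · intro h; apply hγ'; linarith
  · rw [htr]; intro h; apply hγ; linarith

end Literature.LinearAlgebra
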